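import Literature.Computability.QuantumComplexity.PauliPathL1Mass
import HarnessLib

/-!
# The noisy path-ℓ₁ mass and the noise–magic diamond

Topic `Literature/Computability/QuantumComplexity` (cell `qa-dq`, D-0154; census DQ-N7, one dictionary sentence toward
DQ-N4; line L-cand-69 `noisy-mass-diamond`, lens `barrier`; sequel to `PauliPathL1Mass` (L-62) on a NEW object).
L-62 factored the rate OUT of the mass (`|⟨O⟩_err − ⟨O⟩_ℓ| ≤ (1−γ)^{ℓ+1} Λ⁰_{>ℓ}`).  This file folds the rate INTO it:
the **noisy path-ℓ₁ mass** `Λ^γ := Σ_s |f_γ(s)| = Σ_s (1−γ)^{|s|}|f_0(s)|` (`noisyL1Mass`: the tree's `pathCoeff` AT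
RATE `γ`) and the **γ-damped Pauli 1-norm** `‖A‖_γ := 2^{−n} Σ_T (1−γ)^{|T|}|Tr(A T)|` (`dampedPauliL1`, `= pauliL1`
at `γ = 0`).  All statements are PROVED (0 facts, 0 sorries, no instance/notation):

* N1 (theorems): `|⟨O⟩_err| ≤ Λ^γ`, `|⟨O⟩_err − ⟨O⟩_ℓ| ≤ Λ^γ_{>ℓ} ≤ (1−γ)^{ℓ+1} Λ⁰_{>ℓ}` — any layers, no threshold
  (refines L-62's `norm_noisyValue_sub_truncValue_le_tailL1Mass` path by path).
* N2 (theorem `noisyL1Mass_le_budget`): `Λ^γ ≤ c · (Π_t m_t) · ‖O‖_γ` from input brackets `≤ c` and per-layer damped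
  expansions `‖U_t† T U_t‖_γ ≤ m_t` — L-62's peeling induction (`pathL1Mass_le_budget`) run with the tree's
  `pathCoeff_snoc` AT RATE, whose last-layer factor is literally `Tr(O · ℰ_γ(T))`.  No unitarity.
* N3 (theorems): a Pauli-monomial (Clifford) layer has `‖V† T V‖_γ ≤ 1`; a Pauli rotation has
  `‖R_G(θ)† T R_G(θ)‖_γ ≤ max(1, (1−γ)(|cos θ|+|sin θ|))` — EXACTLY Rall–Liang–Cook–Kretschmer's depolarized-rotation
  cost `𝒟(Λ_{f,θ}) = max(1, f|cos θ|+f|sin θ|)`, `f = 1−γ`, inside the tree's uniform-depolarizing path integral.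
* N4 `NoiseMagicDiamond` (record): every layer Pauli-monomial or a rotation with `(1−γ)(|cos θ_t|+|sin θ_t|) ≤ 1` ⇒
  `Λ^γ ≤ c ‖O‖_γ ≤ c ‖O‖_{P,1}` UNIFORMLY in depth, rotation count, geometry and `n` («above the diamond magic never
  accumulates in the noisy ℓ₁ currency»); `γ ≥ 1 − 2^{−1/2}` puts every Clifford + Pauli-rotation circuit there
  (numbers: `0.2928 < 1 − 2^{−1/2} < 0.2929`; the per-angle threshold `1 − (|cos θ|+|sin θ|)^{−1}` → 0 with the angle).
* N5 `NecessityAtRate` (record, lens object): an error `≥ E` at rate `γ` forces `Λ^γ_{>ℓ} ≥ E` (no division by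
  `(1−γ)^{ℓ+1}`); on the catalogued witness (barrier `pauliPathTruncation_worstCase_holds` BY NAME)
  `Λ^p_{>ℓ} ≥ ((3/2)(1−p)²)^k − 1`, growing iff `p < 1 − √(2/3)` (tree `GGCT.threshold_iff`; numbers: `0.1835 < 1 − √(2/3) < 0.1836`).
* N6 (prose + `noisyMassDiamond_numbers`, honest juxtaposition): growth of `Λ^γ` is WITNESSED for `p < 0.1835…` on GGCT's BLOCK-layer
  presentation and EXCLUDED for `p ≥ 0.2929` on any presentation by Clifford and SINGLE-rotation layers with noise
  after EVERY layer — different presentations (what counts as a layer changes the noise model): read as ONE layer,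
  GGCT's block sends `Z₁ ↦ (Z₁+Z₂+Z₃−Z₁Z₂Z₃)/2`, of damped 1-norm `(3/2)(1−p) + (1−p)³/2 > 1` for `p ≤ 0.40` (so that
  layer is outside any `m_t ≤ 1` budget there; its full cost, a max over all strings, is not computed here).  The
  window `0.1835 < p < 0.2929` is addressed by NEITHER inequality; the barrier is never weakened or contradicted.

MEANING CAVEAT.  `Λ^γ` bounds `|⟨O⟩_err|` and truncation errors (ACCURACY of one fixed estimator) and is the textbook
Hoeffding RANGE of the one-path Monte-Carlo estimator (a classical-cost proxy) — inequalities only: no path count, no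
running time, no «efficiently simulable», no sampler or simulator.  Dictionary sentence toward DQ-N4: the thresholds
of `Literature.Barriers.QuantumAdvantage.NoiseThresholdUpperBounds` and the cell's Clifford-polytope records say when a
noisy GATE SET becomes stabilizer-simulable — another currency; the diamond is a threshold for the ℓ₁ mass of one
estimator, no evasion of either is claimed, nothing of theirs is restated.  No summit statement
(`Summit.QuantumAdvantage*`) is touched; BQP vs BPP untouched.

Nearest print (credited): [RallEtAl2019] Def. 2.1–2.2, §2.2 (stabilizer norm, cost recursion, Hoeffding range), §3.4
(Cliffords), §3.5 (`𝒟(Λ_{f,θ}) = max(1, f|cos θ|+f|sin θ|)`, «forms a diamond», depolarized T for `f ≤ 2^{−1/2}`): N2–N4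
are its transplant from single-qubit CHANNELS to the tree's PATH integral (known in print as a Monte-Carlo cost bound);
[GonzalezGarciaCiracTrivedi2025PauliPathBeyondAverageQuantum] Lemma 6 (v)/Thm 3, §7 (magic vs noise BY RATES).  N1/N5/N6: no print found.
-/

noncomputable section

open Matrix Finset

namespace Literature.Computability.QuantumComplexity

namespace PauliPathNoisyMass

open PauliPath PauliPathL1Mass

variable {ι : Type*} [Fintype ι] [DecidableEq ι]

/-! ### §0 Helpers -/

omit [Fintype ι] [DecidableEq ι] in
/-- Sums over `1`-tuples are sums over the entry (plumbing). [folklore] -/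
private theorem sum_fin_one {α β : Type*} [Fintype α] [AddCommMonoid β] (g : (Fin 1 → α) → β) :
    ∑ s, g s = ∑ a, g (fun _ => a) := by
  refine Fintype.sum_equiv (Equiv.funUnique (Fin 1) α) _ _ (fun s => ?_)
  congr 1
  funext i
  simp [Fin.fin_one_eq_zero i]

omit [Fintype ι] [DecidableEq ι] in
/-- Sums over `(d+2)`-tuples are sums over (last entry, initial `(d+1)`-tuple) (plumbing). [folklore] -/
private theorem sum_fin_snoc {α β : Type*} [Fintype α] [AddCommMonoid β] {d : ℕ}
    (g : (Fin (d + 2) → α) → β) :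
    ∑ s, g s = ∑ T : α, ∑ s' : Fin (d + 1) → α, g (Fin.snoc s' T) := by
  rw [← (Fin.snocEquiv fun _ => α).sum_comp, Fintype.sum_prod_type]
  rfl

omit [Fintype ι] [DecidableEq ι] in
/-- `‖1 − γ‖ = 1 − γ` in `ℂ` for a real rate `γ ≤ 1`. [folklore] -/
private theorem norm_one_sub_ofReal {γ : ℝ} (hγ1 : γ ≤ 1) : ‖(1 - (γ : ℂ))‖ = 1 - γ := by
  rw [← Complex.ofReal_one, ← Complex.ofReal_sub, Complex.norm_real, Real.norm_eq_abs, abs_of_nonneg (by linarith)]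

/-- The damped bracket: `|Tr(A · ℰ_γ(T))| = (1−γ)^{|T|} |Tr(A T)|` for a real rate `γ ≤ 1`.
[cite: AharonovEtAl2023, §2 (display after Definition 2: f̃ = (1−γ)^{|s|} f)] -/
theorem norm_trace_mul_depolarizeAll_pauliString {γ : ℝ} (hγ1 : γ ≤ 1) (A : Matrix (ι → Bool) (ι → Bool) ℂ)
    (T : ι → Pauli) :
    ‖(A * depolarizeAll (γ : ℂ) (pauliString T)).trace‖ = (1 - γ) ^ strWeight T * ‖(A * pauliString T).trace‖ := by
  rw [trace_mul_depolarizeAll_pauliString, norm_mul, norm_pow, norm_one_sub_ofReal hγ1]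

omit [DecidableEq ι] in
/-- Anticommuting strings are non-trivial and so is their product: `κ(G,T) = −1 ⇒ |T| ≥ 1 ∧ |G·T| ≥ 1` (a wire where
the letters anticommute carries two distinct non-identity letters). [cite: RudolphEtAl2025, §II B eq. (14) ('P′ = i[G,P]/2 is a new Pauli string')] -/
theorem one_le_strWeight_of_strSign_eq_neg_one {G T : ι → Pauli} (h : strSign G T = -1) :
    1 ≤ strWeight T ∧ 1 ≤ strWeight (stringMul G T) := by
  obtain ⟨i, hi⟩ : ∃ i, Pauli.sign (G i) (T i) ≠ 1 := by
    by_contra hall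
    push Not at hall
    rw [strSign_eq, Finset.prod_eq_one fun i _ => hall i] at h
    norm_num at h
  have key : ∀ a b : Pauli, Pauli.sign a b ≠ 1 → b ≠ Pauli.I ∧ Pauli.letterMul a b ≠ Pauli.I := by
    intro a b; cases a <;> cases b <;> simp [Pauli.sign, Pauli.letterMul]
  exact ⟨Finset.one_le_card.mpr ⟨i, Finset.mem_filter.mpr ⟨Finset.mem_univ i, (key _ _ hi).1⟩⟩,
    Finset.one_le_card.mpr ⟨i, Finset.mem_filter.mpr ⟨Finset.mem_univ i, (key _ _ hi).2⟩⟩⟩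

/-! ### §1 The γ-damped Pauli 1-norm `‖A‖_γ = 2^{-n} Σ_T (1−γ)^{|T|} |Tr(A T)|` -/

/-- The **γ-damped Pauli 1-norm** `‖A‖_γ := 2^{−n} Σ_T (1−γ)^{|T|} |Tr(A T)|`: the stabilizer norm `𝒟` of Rall et al.
with every Pauli coefficient weighted by the survival factor of its string under one round of uniform depolarizing
noise (`= pauliL1 A` at `γ = 0`). [cite: RallEtAl2019, Def. 2.1 (D(A) = 2^{-n} Σ_σ |Tr(σA)|) and §3.5 (PTM R_f of the depolarizing channel)] -/
def dampedPauliL1 (γ : ℝ) (A : Matrix (ι → Bool) (ι → Bool) ℂ) : ℝ :=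
  ((2 : ℝ) ^ Fintype.card ι)⁻¹ * ∑ T : ι → Pauli, (1 - γ) ^ strWeight T * ‖(A * pauliString T).trace‖

/-- `‖A‖_γ ≥ 0` for `γ ≤ 1`. [cite: RallEtAl2019, Def. 2.1] -/
theorem dampedPauliL1_nonneg {γ : ℝ} (hγ1 : γ ≤ 1) (A : Matrix (ι → Bool) (ι → Bool) ℂ) : 0 ≤ dampedPauliL1 γ A := by
  have : 0 ≤ 1 - γ := by linarith
  unfold dampedPauliL1; positivity

/-- `‖A‖_0 = ‖A‖_{P,1}`. [cite: RallEtAl2019, Def. 2.1] -/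
theorem dampedPauliL1_zero (A : Matrix (ι → Bool) (ι → Bool) ℂ) : dampedPauliL1 0 A = pauliL1 A := by
  simp [dampedPauliL1, pauliL1]

/-- `‖A‖_γ ≤ ‖A‖_{P,1}` for `0 ≤ γ ≤ 1` (damping only shrinks coefficients). [cite: RallEtAl2019, Def. 2.1 and §3.5 (R_f)] -/
theorem dampedPauliL1_le_pauliL1 {γ : ℝ} (hγ0 : 0 ≤ γ) (hγ1 : γ ≤ 1) (A : Matrix (ι → Bool) (ι → Bool) ℂ) :
    dampedPauliL1 γ A ≤ pauliL1 A := by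
  unfold dampedPauliL1 pauliL1
  refine mul_le_mul_of_nonneg_left (Finset.sum_le_sum fun T _ => ?_) (by positivity)
  exact (mul_le_mul_of_nonneg_right (pow_le_one₀ (by linarith) (by linarith)) (norm_nonneg _)).trans (by rw [one_mul])

/-- `‖T‖_γ = (1−γ)^{|T|}` on a Pauli string (trace orthogonality). [cite: KempeEtAl2010, §2 (Tr(SS') = 2ⁿ δ)] -/
theorem dampedPauliL1_pauliString (γ : ℝ) (T : ι → Pauli) :
    dampedPauliL1 γ (pauliString T) = (1 - γ) ^ strWeight T := by
  unfold dampedPauliL1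
  simp only [trace_pauliString_mul_pauliString]
  rw [Finset.sum_eq_single T]
  · rw [if_pos rfl, norm_pow, Complex.norm_ofNat, ← mul_assoc, mul_comm (((2 : ℝ) ^ Fintype.card ι)⁻¹),
      mul_assoc, inv_mul_cancel₀ (pow_ne_zero _ two_ne_zero), mul_one]
  · intro S _ hS
    rw [if_neg (Ne.symm hS), norm_zero, mul_zero]
  · intro h
    exact absurd (Finset.mem_univ T) h

/-- Homogeneity `‖c A‖_γ = |c| ‖A‖_γ`. [cite: RallEtAl2019, Def. 2.1] -/
theorem dampedPauliL1_smul (γ : ℝ) (c : ℂ) (A : Matrix (ι → Bool) (ι → Bool) ℂ) :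
    dampedPauliL1 γ (c • A) = ‖c‖ * dampedPauliL1 γ A := by
  unfold dampedPauliL1
  simp only [Matrix.smul_mul, Matrix.trace_smul, smul_eq_mul, norm_mul, Finset.mul_sum]
  exact Finset.sum_congr rfl fun T _ => by ring

/-- Subadditivity `‖A + B‖_γ ≤ ‖A‖_γ + ‖B‖_γ` for `γ ≤ 1`. [cite: RallEtAl2019, Def. 2.1] -/
theorem dampedPauliL1_add_le {γ : ℝ} (hγ1 : γ ≤ 1) (A B : Matrix (ι → Bool) (ι → Bool) ℂ) :
    dampedPauliL1 γ (A + B) ≤ dampedPauliL1 γ A + dampedPauliL1 γ B := by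
  unfold dampedPauliL1
  rw [← mul_add, ← Finset.sum_add_distrib]
  refine mul_le_mul_of_nonneg_left (Finset.sum_le_sum fun T _ => ?_) (by positivity)
  rw [Matrix.add_mul, Matrix.trace_add, ← mul_add]
  exact mul_le_mul_of_nonneg_left (norm_add_le _ _) (pow_nonneg (by linarith) _)

/-! ### §2 N3 — layer costs at rate: Cliffords `≤ 1`, a rotation `≤ max(1, (1−γ)(|cos θ|+|sin θ|))` -/

/-- **Clifford layers cost at most `1` at every rate**: a Pauli-monomial layer (`V† T V = c T'`, `|c| ≤ 1`, tree
`PauliPathL1Mass.IsPauliMonomialLayer`) has `‖V† T V‖_γ = |c| (1−γ)^{|T'|} ≤ 1`.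
[cite: RallEtAl2019, §3.4 (Clifford PTM = signed permutation; D(Λ) = induced 1-norm, Prop. 3.9)] -/
theorem dampedPauliL1_conj_le_one_of_monomial {γ : ℝ} (hγ0 : 0 ≤ γ) (hγ1 : γ ≤ 1)
    {V : Matrix (ι → Bool) (ι → Bool) ℂ} (hV : IsPauliMonomialLayer V) (T : ι → Pauli) :
    dampedPauliL1 γ (Vᴴ * pauliString T * V) ≤ 1 := by
  obtain ⟨T', c, hc, h⟩ := hV T
  rw [h, dampedPauliL1_smul, dampedPauliL1_pauliString]
  exact mul_le_one₀ hc (pow_nonneg (by linarith) _) (pow_le_one₀ (by linarith) (by linarith))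

/-- **A Pauli rotation costs at most `max(1, (1−γ)(|cos θ|+|sin θ|))` at rate `γ`** = Rall et al.'s
`𝒟(Λ_{f,θ}) = max(1, f|cos θ|+f|sin θ|)`, `f = 1−γ`: a commuting string returns unchanged (`(1−γ)^{|T|} ≤ 1`); an
anticommuting one branches into `cos θ·T + i sin θ·GT`, two strings of weight `≥ 1`, each damped by at least `1−γ`.
[cite: RallEtAl2019, §3.5 (PTM R_f R_θ; D(Λ_{f,θ}) = max(1, f|cos θ|+f|sin θ|))] [cite: RudolphEtAl2025, §II B eq. (14) (branching rule)] -/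
theorem dampedPauliL1_rotConj_pauliString_le {γ : ℝ} (hγ0 : 0 ≤ γ) (hγ1 : γ ≤ 1) (θ : ℝ) (G T : ι → Pauli) :
    dampedPauliL1 γ ((PauliPropagation.pauliRot θ G)ᴴ * pauliString T * PauliPropagation.pauliRot θ G) ≤
      max 1 ((1 - γ) * (|Real.cos θ| + |Real.sin θ|)) := by
  have h0 : 0 ≤ 1 - γ := by linarith
  rw [← PauliPropagation.rotConj_eq]
  rcases OTOC.strSign_eq_one_or G T with h | h
  · rw [PauliPropagation.rotConj_pauliString_of_comm θ h, dampedPauliL1_pauliString]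
    exact (pow_le_one₀ h0 (by linarith)).trans (le_max_left _ _)
  · rw [PauliPropagation.rotConj_pauliString_of_anticomm θ h]
    obtain ⟨hT, hGT⟩ := one_le_strWeight_of_strSign_eq_neg_one h
    have hsp : ‖stringPhase G T‖ = 1 := by
      rcases PauliPropagation.I_mul_stringPhase_eq_or h with h1 | h1 <;> simpa using congrArg norm h1
    have hwT : (1 - γ) ^ strWeight T ≤ 1 - γ :=
      (pow_le_pow_of_le_one h0 (by linarith) hT).trans (pow_one _).le
    have hwGT : (1 - γ) ^ strWeight (stringMul G T) ≤ 1 - γ :=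
      (pow_le_pow_of_le_one h0 (by linarith) hGT).trans (pow_one _).le
    refine (dampedPauliL1_add_le hγ1 _ _).trans ?_
    rw [dampedPauliL1_smul, dampedPauliL1_pauliString, Complex.norm_real, Real.norm_eq_abs, dampedPauliL1_smul,
      norm_mul, Complex.norm_I, one_mul, Complex.norm_real, Real.norm_eq_abs, pauliString_mul, dampedPauliL1_smul,
      hsp, one_mul, dampedPauliL1_pauliString]
    calc |Real.cos θ| * (1 - γ) ^ strWeight T + |Real.sin θ| * (1 - γ) ^ strWeight (stringMul G T)
        ≤ |Real.cos θ| * (1 - γ) + |Real.sin θ| * (1 - γ) :=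
          add_le_add (mul_le_mul_of_nonneg_left hwT (abs_nonneg _)) (mul_le_mul_of_nonneg_left hwGT (abs_nonneg _))
      _ = (1 - γ) * (|Real.cos θ| + |Real.sin θ|) := by ring
      _ ≤ max 1 ((1 - γ) * (|Real.cos θ| + |Real.sin θ|)) := le_max_right _ _

omit [Fintype ι] [DecidableEq ι] in
/-- **T-angle layers enter the diamond at `γ ≥ 1 − 2^{−1/2}`** (and so does every angle, by `|cos θ|+|sin θ| ≤ √2`).
[cite: RallEtAl2019, §3.5 («the depolarized T gate becomes SH when f ≤ 2^{-1/2} ≈ 0.707»)] -/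
theorem diamond_of_ge_one_sub_inv_sqrt_two {γ : ℝ} (hγ : 1 - (Real.sqrt 2)⁻¹ ≤ γ) (θ : ℝ) :
    (1 - γ) * (|Real.cos θ| + |Real.sin θ|) ≤ 1 := by
  have hs : 0 < Real.sqrt 2 := Real.sqrt_pos.2 (by norm_num)
  have h1 : 1 - γ ≤ (Real.sqrt 2)⁻¹ := by linarith
  calc (1 - γ) * (|Real.cos θ| + |Real.sin θ|) ≤ (Real.sqrt 2)⁻¹ * Real.sqrt 2 :=
        mul_le_mul h1 (abs_cos_add_abs_sin_le_sqrt_two θ) (by positivity) (by positivity)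
    _ = 1 := inv_mul_cancel₀ hs.ne'

/-! ### §3 The noisy path-ℓ₁ mass and N1 — tails at rate -/

/-- The **noisy path-ℓ₁ mass** `Λ^γ(U,ρ,O) := Σ_s |f_γ(s)| = Σ_s (1−γ)^{|s|} |f_0(s)|` — the tree's path coefficients AT
RATE `γ` (`pathCoeff_eq_pow_mul_pathCoeff_zero`); `Λ⁰ = pathL1Mass`.
[cite: AharonovEtAl2023, Definition 2 (f̃(C,s,·) = (1−γ)^{|s|} f(C,s,·))] [cite: RallEtAl2019, §2.2 (the magnitude ĉ of the propagated estimator)] -/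
def noisyL1Mass (γ : ℝ) {d : ℕ} (U : Fin d → Matrix (ι → Bool) (ι → Bool) ℂ)
    (ρ O : Matrix (ι → Bool) (ι → Bool) ℂ) : ℝ :=
  ∑ s : Fin (d + 1) → ι → Pauli, ‖pathCoeff (γ : ℂ) U ρ O s‖

/-- The **noisy tail mass** `Λ^γ_{>ℓ} := Σ_{|s| > ℓ} |f_γ(s)|` (what the weight-`ℓ` estimator drops, at rate).
[cite: GonzalezGarciaCiracTrivedi2025PauliPathBeyondAverageQuantum, §3 (⟨O⟩_ℓ drops the paths of weight > ℓ)] -/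
def noisyTailL1Mass (γ : ℝ) (ℓ : ℕ) {d : ℕ} (U : Fin d → Matrix (ι → Bool) (ι → Bool) ℂ)
    (ρ O : Matrix (ι → Bool) (ι → Bool) ℂ) : ℝ :=
  ∑ s ∈ Finset.univ.filter (fun s : Fin (d + 1) → ι → Pauli => ¬ pathWeight s ≤ ℓ), ‖pathCoeff (γ : ℂ) U ρ O s‖

/-- `Λ⁰ = Λ` (the rate-`0` noisy mass is L-62's path-ℓ₁ mass). [cite: AharonovEtAl2023, Definition 2 (f̃ = f at γ = 0)] -/
theorem noisyL1Mass_zero {d : ℕ} (U : Fin d → Matrix (ι → Bool) (ι → Bool) ℂ) (ρ O : Matrix (ι → Bool) (ι → Bool) ℂ) :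
    noisyL1Mass 0 U ρ O = pathL1Mass U ρ O := by
  simp [noisyL1Mass, pathL1Mass]

/-- **`|⟨O⟩_err| ≤ Λ^γ`** for every circuit, input, observable and real rate (the noisy value IS the path sum, tree
`noisyValue_eq_sum_pathCoeff`). [cite: AharonovEtAl2023, §2 (Lemma 4: p̃ = Σ_s f̃(C,s,·))] [cite: RallEtAl2019, §2.2 (|ĉ_k Tr(σ̂_k E)| bounded by the product of costs)] -/
theorem norm_noisyValue_le_noisyL1Mass (γ : ℝ) {d : ℕ} (U : Fin d → Matrix (ι → Bool) (ι → Bool) ℂ)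
    (ρ O : Matrix (ι → Bool) (ι → Bool) ℂ) : ‖noisyValue (γ : ℂ) U ρ O‖ ≤ noisyL1Mass γ U ρ O := by
  rw [noisyValue_eq_sum_pathCoeff]
  exact norm_sum_le _ _

/-- **`|⟨O⟩_err − ⟨O⟩_ℓ| ≤ Λ^γ_{>ℓ}`** for every circuit, input, observable, `ℓ` and real rate — no threshold, no
unitarity (tree `noisyValue_sub_truncValue`). [cite: GonzalezGarciaCiracTrivedi2025PauliPathBeyondAverageQuantum, §3 and proof of Theorem 1 (|⟨O⟩_err − ⟨O⟩_ℓ| bounded path by path)] -/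
theorem norm_noisyValue_sub_truncValue_le_noisyTailL1Mass (γ : ℝ) (ℓ : ℕ) {d : ℕ}
    (U : Fin d → Matrix (ι → Bool) (ι → Bool) ℂ) (ρ O : Matrix (ι → Bool) (ι → Bool) ℂ) :
    ‖noisyValue (γ : ℂ) U ρ O - truncValue (γ : ℂ) ℓ U ρ O‖ ≤ noisyTailL1Mass γ ℓ U ρ O := by
  rw [noisyValue_sub_truncValue]
  exact norm_sum_le _ _

/-- **`Λ^γ_{>ℓ} ≤ (1−γ)^{ℓ+1} Λ⁰_{>ℓ}`** for `0 ≤ γ ≤ 1`: every dropped path has `|f_γ(s)| = (1−γ)^{|s|}|f_0(s)|` with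
`|s| ≥ ℓ + 1` — so N1 refines L-62's R1 path by path. [cite: GonzalezGarciaCiracTrivedi2025PauliPathBeyondAverageQuantum, proof of Theorem 1 (error ≤ Σ_{w>ℓ} (1−p)^w Σ|f(s)|)] -/
theorem noisyTailL1Mass_le_pow_mul_tailL1Mass {γ : ℝ} (hγ0 : 0 ≤ γ) (hγ1 : γ ≤ 1) (ℓ : ℕ) {d : ℕ}
    (U : Fin d → Matrix (ι → Bool) (ι → Bool) ℂ) (ρ O : Matrix (ι → Bool) (ι → Bool) ℂ) :
    noisyTailL1Mass γ ℓ U ρ O ≤ (1 - γ) ^ (ℓ + 1) * tailL1Mass ℓ U ρ O := by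
  rw [noisyTailL1Mass, tailL1Mass, Finset.mul_sum]
  refine Finset.sum_le_sum fun s hs => ?_
  have hw : ℓ + 1 ≤ pathWeight s := Nat.succ_le_of_lt (not_le.mp (Finset.mem_filter.mp hs).2)
  rw [pathCoeff_eq_pow_mul_pathCoeff_zero, norm_mul, norm_pow, norm_one_sub_ofReal hγ1]
  exact mul_le_mul_of_nonneg_right (pow_le_pow_of_le_one (by linarith) (by linarith) hw) (norm_nonneg _)

/-! ### §4 N2 — the noisy layer budget (induction with `pathCoeff_snoc` at rate) -/

/-- **N2, the noisy layer budget**: `Λ^γ ≤ c · (Π_t m_t) · ‖O‖_γ` whenever the input brackets are `≤ c` and layer `t`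
has damped expansion `‖U_t† T U_t‖_γ ≤ m_t` on every string — L-62's peeling induction (`pathL1Mass_le_budget`) at rate:
the tree's `pathCoeff_snoc` turns the read-out `O` into the DAMPED brackets `2^{-n} Tr(O ℰ_γ(T))` against the conjugates
`U_d† T U_d`, budgeted by the induction hypothesis (stated for every observable) and `hm`.  No unitarity.  = the
path-sum form of Rall et al.'s recursion `𝒟(ρ₀) Π_i 𝒟(Λ_i) max_σ|Tr(σE)|`. [cite: RallEtAl2019, §2.2 (cost recursion and bound after Def. 2.2)] -/
theorem noisyL1Mass_le_budget {γ : ℝ} (hγ1 : γ ≤ 1) :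
    ∀ (d : ℕ) (U : Fin d → Matrix (ι → Bool) (ι → Bool) ℂ) (ρ O : Matrix (ι → Bool) (ι → Bool) ℂ) (c : ℝ)
      (m : Fin d → ℝ) (_hρ : ∀ S : ι → Pauli, ‖(pauliString S * ρ).trace‖ ≤ c)
      (_hm : ∀ (t : Fin d) (T : ι → Pauli), dampedPauliL1 γ ((U t)ᴴ * pauliString T * U t) ≤ m t),
      noisyL1Mass γ U ρ O ≤ c * (∏ t, m t) * dampedPauliL1 γ O := by
  intro d
  induction d with
  | zero =>
    intro U ρ O c m hρ _hm
    unfold noisyL1Mass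
    calc ∑ s : Fin (0 + 1) → ι → Pauli, ‖pathCoeff (γ : ℂ) U ρ O s‖
        = ∑ S : ι → Pauli, ((2 : ℝ) ^ Fintype.card ι)⁻¹ *
            ((1 - γ) ^ strWeight S * ‖(O * pauliString S).trace‖ * ‖(pauliString S * ρ).trace‖) := by
          rw [sum_fin_one]
          refine Finset.sum_congr rfl fun S _ => ?_
          simp only [pathCoeff, Fin.prod_univ_zero, mul_one, zero_add, pow_one, norm_mul, norm_inv, norm_pow,
            Complex.norm_ofNat]
          rw [norm_trace_mul_depolarizeAll_pauliString hγ1]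
      _ ≤ ∑ S : ι → Pauli, ((2 : ℝ) ^ Fintype.card ι)⁻¹ *
            ((1 - γ) ^ strWeight S * ‖(O * pauliString S).trace‖ * c) :=
          Finset.sum_le_sum fun S _ =>
            mul_le_mul_of_nonneg_left (mul_le_mul_of_nonneg_left (hρ S)
              (mul_nonneg (pow_nonneg (by linarith) _) (norm_nonneg _))) (by positivity)
      _ = c * (∏ t : Fin 0, m t) * dampedPauliL1 γ O := by
          rw [Fin.prod_univ_zero, mul_one, dampedPauliL1, Finset.mul_sum, Finset.mul_sum]
          exact Finset.sum_congr rfl fun S _ => by ring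
  | succ d ih =>
    intro U ρ O c m hρ hm
    have h0 : 0 ≤ 1 - γ := by linarith
    have hc : 0 ≤ c := (norm_nonneg _).trans (hρ fun _ => Pauli.I)
    have hm0 : ∀ t, 0 ≤ m t := fun t => (dampedPauliL1_nonneg hγ1 _).trans (hm t fun _ => Pauli.I)
    have hinner : ∀ T : ι → Pauli,
        noisyL1Mass γ (fun i : Fin d => U i.castSucc) ρ ((U (Fin.last d))ᴴ * pauliString T * U (Fin.last d)) ≤
          c * (∏ t : Fin d, m t.castSucc) * m (Fin.last d) := by
      intro T
      have h := ih (fun i : Fin d => U i.castSucc) ρ ((U (Fin.last d))ᴴ * pauliString T * U (Fin.last d)) c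
        (fun t => m t.castSucc) hρ (fun t T' => hm t.castSucc T')
      exact h.trans (mul_le_mul_of_nonneg_left (hm (Fin.last d) T)
        (mul_nonneg hc (Finset.prod_nonneg fun t _ => hm0 _)))
    unfold noisyL1Mass at hinner ⊢
    rw [sum_fin_snoc]
    calc ∑ T : ι → Pauli, ∑ s' : Fin (d + 1) → ι → Pauli, ‖pathCoeff (γ : ℂ) U ρ O (Fin.snoc s' T)‖
        = ∑ T : ι → Pauli, ((2 : ℝ) ^ Fintype.card ι)⁻¹ * ((1 - γ) ^ strWeight T * ‖(O * pauliString T).trace‖) *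
            ∑ s' : Fin (d + 1) → ι → Pauli, ‖pathCoeff (γ : ℂ) (fun i : Fin d => U i.castSucc) ρ
              ((U (Fin.last d))ᴴ * pauliString T * U (Fin.last d)) s'‖ := by
          refine Finset.sum_congr rfl fun T _ => ?_
          rw [Finset.mul_sum]
          refine Finset.sum_congr rfl fun s' _ => ?_
          rw [pathCoeff_snoc, norm_mul, norm_mul, norm_inv, norm_pow, Complex.norm_ofNat,
            norm_trace_mul_depolarizeAll_pauliString hγ1]
      _ ≤ ∑ T : ι → Pauli, ((2 : ℝ) ^ Fintype.card ι)⁻¹ * ((1 - γ) ^ strWeight T * ‖(O * pauliString T).trace‖) *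
            (c * (∏ t : Fin d, m t.castSucc) * m (Fin.last d)) :=
          Finset.sum_le_sum fun T _ => mul_le_mul_of_nonneg_left (hinner T)
            (mul_nonneg (by positivity) (mul_nonneg (pow_nonneg h0 _) (norm_nonneg _)))
      _ = c * (∏ t : Fin (d + 1), m t) * dampedPauliL1 γ O := by
          rw [Fin.prod_univ_castSucc, dampedPauliL1, Finset.mul_sum, Finset.mul_sum]
          exact Finset.sum_congr rfl fun T _ => by ring

/-! ### §5 Record N4 — the diamond: above `(1−γ)(|cos θ|+|sin θ|) ≤ 1` per rotation, no growth at any depth -/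

/-- A layer **lies in the γ-diamond** if it is Pauli-monomial (Clifford, Pauli string, identity) or a Pauli rotation
`R_G(θ)` with `(1−γ)(|cos θ| + |sin θ|) ≤ 1`. [cite: RallEtAl2019, §3.5 («the boundary of D ≤ 1 … forms a diamond»)] -/
def InDiamond (γ : ℝ) (V : Matrix (ι → Bool) (ι → Bool) ℂ) : Prop :=
  IsPauliMonomialLayer V ∨
    ∃ (θ : ℝ) (G : ι → Pauli), V = PauliPropagation.pauliRot θ G ∧ (1 - γ) * (|Real.cos θ| + |Real.sin θ|) ≤ 1

/-- A layer in the diamond has damped expansion `≤ 1` on every string. [cite: RallEtAl2019, §3.4–§3.5] -/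
theorem dampedPauliL1_conj_le_one_of_inDiamond {γ : ℝ} (hγ0 : 0 ≤ γ) (hγ1 : γ ≤ 1)
    {V : Matrix (ι → Bool) (ι → Bool) ℂ} (hV : InDiamond γ V) (T : ι → Pauli) :
    dampedPauliL1 γ (Vᴴ * pauliString T * V) ≤ 1 := by
  rcases hV with hV | ⟨θ, G, rfl, hθ⟩
  · exact dampedPauliL1_conj_le_one_of_monomial hγ0 hγ1 hV T
  · exact (dampedPauliL1_rotConj_pauliString_le hγ0 hγ1 θ G T).trans (max_le le_rfl hθ)

/-- **The diamond theorem**: if every layer lies in the γ-diamond, then `Λ^γ ≤ c · ‖O‖_γ ≤ c · ‖O‖_{P,1}` — uniformly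
in the depth `d`, the number of rotations, the geometry and `n`: above the diamond, magic never accumulates in the
noisy ℓ₁ currency (hence `|⟨O⟩_err| ≤ c ‖O‖_γ` and every truncation error `≤ c ‖O‖_γ`, by N1).
[cite: RallEtAl2019, §3.5 (D(Λ_{f,θ}) ≤ 1 inside the diamond) and §2.2 (the product of costs)] -/
theorem noisyL1Mass_le_of_inDiamond {γ : ℝ} (hγ0 : 0 ≤ γ) (hγ1 : γ ≤ 1) {d : ℕ}
    {U : Fin d → Matrix (ι → Bool) (ι → Bool) ℂ} (hU : ∀ t, InDiamond γ (U t)) (ρ O : Matrix (ι → Bool) (ι → Bool) ℂ)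
    {c : ℝ} (hρ : ∀ S : ι → Pauli, ‖(pauliString S * ρ).trace‖ ≤ c) :
    noisyL1Mass γ U ρ O ≤ c * dampedPauliL1 γ O ∧ c * dampedPauliL1 γ O ≤ c * pauliL1 O := by
  have hc : 0 ≤ c := (norm_nonneg _).trans (hρ fun _ => Pauli.I)
  have h := noisyL1Mass_le_budget hγ1 d U ρ O c (fun _ => 1) hρ
    (fun t T => dampedPauliL1_conj_le_one_of_inDiamond hγ0 hγ1 (hU t) T)
  rw [Finset.prod_const_one, mul_one] at h
  exact ⟨h, mul_le_mul_of_nonneg_left (dampedPauliL1_le_pauliL1 hγ0 hγ1 O) hc⟩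

/-- **Every Clifford + Pauli-rotation circuit is in the diamond once `γ ≥ 1 − 2^{−1/2}`** (T-angle layers exactly at
the T threshold; smaller angles earlier): then `Λ^γ ≤ c ‖O‖_γ` whatever the rotation count.
[cite: RallEtAl2019, §3.5 (depolarized T: f ≤ 2^{-1/2})] -/
theorem noisyL1Mass_le_of_ge_threshold {γ : ℝ} (hγ1 : γ ≤ 1) (hγ : 1 - (Real.sqrt 2)⁻¹ ≤ γ) {d : ℕ}
    {U : Fin d → Matrix (ι → Bool) (ι → Bool) ℂ}
    (hU : ∀ t, IsPauliMonomialLayer (U t) ∨ ∃ (θ : ℝ) (G : ι → Pauli), U t = PauliPropagation.pauliRot θ G)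
    (ρ O : Matrix (ι → Bool) (ι → Bool) ℂ) {c : ℝ} (hρ : ∀ S : ι → Pauli, ‖(pauliString S * ρ).trace‖ ≤ c) :
    noisyL1Mass γ U ρ O ≤ c * dampedPauliL1 γ O := by
  have hs : (Real.sqrt 2)⁻¹ ≤ 1 :=
    inv_le_one_of_one_le₀ (by rw [← Real.sqrt_one]; exact Real.sqrt_le_sqrt (by norm_num))
  have hγ0 : 0 ≤ γ := by linarith
  refine (noisyL1Mass_le_of_inDiamond hγ0 hγ1 (fun t => ?_) ρ O hρ).1
  rcases hU t with h | ⟨θ, G, h⟩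
  · exact Or.inl h
  · exact Or.inr ⟨θ, G, h, diamond_of_ge_one_sub_inv_sqrt_two hγ θ⟩

/-- (N4, record) **The noise–magic diamond in the ℓ₁ currency**: layers in the γ-diamond ⇒ `Λ^γ ≤ c ‖O‖_γ ≤ c ‖O‖_{P,1}`
for every depth; and `γ ≥ 1 − 2^{−1/2}` puts every Clifford + Pauli-rotation circuit in the diamond.
[cite: RallEtAl2019, §3.5 (the diamond; depolarized T at f ≤ 2^{-1/2}) and §2.2] -/
def NoiseMagicDiamond : Prop :=
  ∀ {ι : Type} [Fintype ι] [DecidableEq ι] (γ : ℝ) (_hγ0 : 0 ≤ γ) (_hγ1 : γ ≤ 1) {d : ℕ}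
    (U : Fin d → Matrix (ι → Bool) (ι → Bool) ℂ) (ρ O : Matrix (ι → Bool) (ι → Bool) ℂ) (c : ℝ)
    (_hρ : ∀ S : ι → Pauli, ‖(pauliString S * ρ).trace‖ ≤ c),
    ((∀ t, InDiamond γ (U t)) →
        noisyL1Mass γ U ρ O ≤ c * dampedPauliL1 γ O ∧ c * dampedPauliL1 γ O ≤ c * pauliL1 O) ∧
      ((1 - (Real.sqrt 2)⁻¹ ≤ γ) →
        (∀ t, IsPauliMonomialLayer (U t) ∨ ∃ (θ : ℝ) (G : ι → Pauli), U t = PauliPropagation.pauliRot θ G) →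
          noisyL1Mass γ U ρ O ≤ c * dampedPauliL1 γ O)

/-- N4 holds. [cite: RallEtAl2019, §3.5 and §2.2] -/
theorem noiseMagicDiamond_holds : NoiseMagicDiamond := fun _ hγ0 hγ1 _ _ ρ O _ hρ =>
  ⟨fun hU => noisyL1Mass_le_of_inDiamond hγ0 hγ1 hU ρ O hρ,
    fun hγ hU => noisyL1Mass_le_of_ge_threshold hγ1 hγ hU ρ O hρ⟩

/-! ### §6 Record N5 — necessity at rate and the catalogued witness (lens object) -/

/-- **Necessity at rate**: a truncation error `≥ E` at rate `γ` forces noisy tail mass `Λ^γ_{>ℓ} ≥ E` — no division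
by `(1−γ)^{ℓ+1}` (contrast L-62's `tailL1Mass_ge_of_error_ge`). [cite: GonzalezGarciaCiracTrivedi2025PauliPathBeyondAverageQuantum, §3 and Theorem 3 (the error is carried by the dropped paths)] -/
theorem noisyTailL1Mass_ge_of_error_ge (γ : ℝ) (ℓ : ℕ) {d : ℕ} (U : Fin d → Matrix (ι → Bool) (ι → Bool) ℂ)
    (ρ O : Matrix (ι → Bool) (ι → Bool) ℂ) {E : ℝ}
    (hE : E ≤ ‖noisyValue (γ : ℂ) U ρ O - truncValue (γ : ℂ) ℓ U ρ O‖) : E ≤ noisyTailL1Mass γ ℓ U ρ O :=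
  hE.trans (norm_noisyValue_sub_truncValue_le_noisyTailL1Mass γ ℓ U ρ O)

open Literature.Barriers.QuantumAdvantage in
/-- **The catalogued witness carries exponential NOISY tail mass**: for `0 ≤ p < 1 − √(2/3)`, `2k < ℓ ≤ 9k/4`,
`Λ^p_{>ℓ}(C_k) ≥ ((3/2)(1−p)²)^k − 1` — the barrier `pauliPathTruncation_worstCase_holds` BY NAME through N5; the
right-hand side grows with `k` exactly when `(3/2)(1−p)² > 1`, i.e. `p < 1 − √(2/3)` (tree: `GGCT.threshold_iff`, by name).
[cite: GonzalezGarciaCiracTrivedi2025PauliPathBeyondAverageQuantum, Lemma 6 (v) and Theorem 3] -/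
theorem ggct_witness_noisyTailL1Mass_ge (p : ℝ) (hp0 : 0 ≤ p) (hp : p < 1 - Real.sqrt (2 / 3)) (k ℓ : ℕ)
    (hkℓ : 2 * k < ℓ) (hℓk : 4 * ℓ ≤ 9 * k) :
    (3 / 2 * (1 - p) ^ 2) ^ k - 1 ≤
      noisyTailL1Mass p ℓ (GGCT.layers k) (GGCT.input k) (pauliString (GGCT.obs k)) :=
  noisyTailL1Mass_ge_of_error_ge p ℓ (GGCT.layers k) (GGCT.input k) (pauliString (GGCT.obs k))
    (pauliPathTruncation_worstCase_holds p hp0 hp k ℓ hkℓ hℓk)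

/-- (N5, record) **Necessity at rate + the witness**. [cite: GonzalezGarciaCiracTrivedi2025PauliPathBeyondAverageQuantum, Lemma 6 (v) and Theorem 3] -/
def NecessityAtRate : Prop :=
  (∀ {ι : Type} [Fintype ι] [DecidableEq ι] (γ : ℝ) (ℓ : ℕ) {d : ℕ} (U : Fin d → Matrix (ι → Bool) (ι → Bool) ℂ)
      (ρ O : Matrix (ι → Bool) (ι → Bool) ℂ) (E : ℝ)
      (_hE : E ≤ ‖noisyValue (γ : ℂ) U ρ O - truncValue (γ : ℂ) ℓ U ρ O‖), E ≤ noisyTailL1Mass γ ℓ U ρ O) ∧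
    ∀ (p : ℝ) (_hp0 : 0 ≤ p) (_hp : p < 1 - Real.sqrt (2 / 3)) (k ℓ : ℕ) (_hkℓ : 2 * k < ℓ) (_hℓk : 4 * ℓ ≤ 9 * k),
      (3 / 2 * (1 - p) ^ 2) ^ k - 1 ≤
        noisyTailL1Mass p ℓ (Literature.Barriers.QuantumAdvantage.GGCT.layers k)
          (Literature.Barriers.QuantumAdvantage.GGCT.input k)
          (pauliString (Literature.Barriers.QuantumAdvantage.GGCT.obs k))

/-- N5 holds. [cite: GonzalezGarciaCiracTrivedi2025PauliPathBeyondAverageQuantum, Lemma 6 (v) and Theorem 3] -/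
theorem necessityAtRate_holds : NecessityAtRate :=
  ⟨fun γ ℓ _ U ρ O _ hE => noisyTailL1Mass_ge_of_error_ge γ ℓ U ρ O hE,
    fun p hp0 hp k ℓ hkℓ hℓk => ggct_witness_noisyTailL1Mass_ge p hp0 hp k ℓ hkℓ hℓk⟩

/-! ### §7 Numbers (record) — the two thresholds and the gap between the presentations -/

/-- **Numbers**: `1.41421 < √2 < 1.41422` ⇒ T-layer diamond threshold `0.2928 < 1 − 2^{−1/2} < 0.2929`;
`0.8164 < √(2/3) < 0.8165` ⇒ GGCT growth threshold `0.1835 < 1 − √(2/3) < 0.1836`; the regimes are disjoint; GGCT's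
block read as ONE layer: the damped 1-norm `(3/2)(1−p) + (1−p)³/2` of `V†Z₁V = (Z₁+Z₂+Z₃−Z₁Z₂Z₃)/2` is `> 1` at
`p = 0.40` and `< 1` at `0.41` (N6: different presentations; the block's full layer cost is not computed). [cite: RallEtAl2019, §3.5 (f ≤ 2^{-1/2} ≈ 0.707)] [cite: GonzalezGarciaCiracTrivedi2025PauliPathBeyondAverageQuantum, Theorem 3 (p < 1 − √(2/3)) and Lemma 6 (iv) (V†Z₁V)] -/
theorem noisyMassDiamond_numbers :
    (1.41421 : ℝ) < Real.sqrt 2 ∧ Real.sqrt 2 < 1.41422 ∧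
      (0.2928 : ℝ) < 1 - (Real.sqrt 2)⁻¹ ∧ 1 - (Real.sqrt 2)⁻¹ < 0.2929 ∧
        (0.8164 : ℝ) < Real.sqrt (2 / 3) ∧ Real.sqrt (2 / 3) < 0.8165 ∧
          (0.1835 : ℝ) < 1 - Real.sqrt (2 / 3) ∧ 1 - Real.sqrt (2 / 3) < 0.1836 ∧
            1 - Real.sqrt (2 / 3) < 1 - (Real.sqrt 2)⁻¹ ∧
              (1 : ℝ) < 3 / 2 * (1 - 0.40) + (1 - 0.40) ^ 3 / 2 ∧
                3 / 2 * (1 - 0.41) + (1 - 0.41) ^ 3 / 2 < (1 : ℝ) := by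
  have hs1 : (1.41421 : ℝ) < Real.sqrt 2 := (Real.lt_sqrt (by norm_num)).2 (by norm_num)
  have hs2 : Real.sqrt 2 < 1.41422 := (Real.sqrt_lt' (by norm_num)).2 (by norm_num)
  have ht1 : (0.8164 : ℝ) < Real.sqrt (2 / 3) := (Real.lt_sqrt (by norm_num)).2 (by norm_num)
  have ht2 : Real.sqrt (2 / 3) < 0.8165 := (Real.sqrt_lt' (by norm_num)).2 (by norm_num)
  have hpos : 0 < Real.sqrt 2 := by linarith
  have hi1 : (Real.sqrt 2)⁻¹ < 0.7072 := by
    rw [inv_lt_comm₀ hpos (by norm_num)]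
    exact lt_trans (by norm_num) hs1
  have hi2 : (0.7071 : ℝ) < (Real.sqrt 2)⁻¹ := by
    rw [lt_inv_comm₀ (by norm_num) hpos]
    exact lt_trans hs2 (by norm_num)
  refine ⟨hs1, hs2, by linarith, by linarith, ht1, ht2, by linarith, by linarith, by linarith, by norm_num, by norm_num⟩

/-! ### §8 Target -/

/-- **Target of the line** (`noisy-mass-diamond`): the two records N4 ∧ N5 (N1–N3 are the plain theorems
`norm_noisyValue_le_noisyL1Mass`, `norm_noisyValue_sub_truncValue_le_noisyTailL1Mass`,
`noisyTailL1Mass_le_pow_mul_tailL1Mass`, `noisyL1Mass_le_budget`, `dampedPauliL1_conj_le_one_of_monomial`,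
`dampedPauliL1_rotConj_pauliString_le`, all proved above).
[cite: RallEtAl2019, §2.2 and §3.5] [cite: GonzalezGarciaCiracTrivedi2025PauliPathBeyondAverageQuantum, Theorem 3] -/
def PauliPathNoisyMassTarget : Prop :=
  NoiseMagicDiamond ∧ NecessityAtRate

/-- The target holds (0 facts, 0 sorries). [cite: RallEtAl2019, §2.2 and §3.5] [cite: GonzalezGarciaCiracTrivedi2025PauliPathBeyondAverageQuantum, Theorem 3] -/
theorem pauliPathNoisyMassTarget_holds : PauliPathNoisyMassTarget :=
  ⟨noiseMagicDiamond_holds, necessityAtRate_holds⟩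

end PauliPathNoisyMass

end Literature.Computability.QuantumComplexity
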